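import Summits.CriticalPhenomena.PercolationContinuityZ3.Theorems.Transplant.GrigorchukGrowthRecursion
import Summits.CriticalPhenomena.PercolationContinuityZ3.Theorems.Transplant.GrigorchukCriticalProbLtOne
import Literature.Barriers.CriticalPhenomena.BLPSCriticalReduction
import Literature.Probability.Percolation.UniquenessAmenable
import Mathlib.Analysis.SpecialFunctions.Pow.Real
import Mathlib.Analysis.SpecificLimits.Basic
import HarnessLib

/-!
# THE FIRST GRIGORCHUK GROUP HAS SUBEXPONENTIAL GROWTH — KERNEL (Grigorchuk 1984's upper bound, level-one weighted form); hence
# `Cay(𝔊; a, b, c, d)` is AMENABLE and `p_u = p_c < 1` there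

builds on p205010 (kernel theorem, internal audit signed; external expert review pending) — nothing in this file uses p205010; growth / amenability / the
HYPOTHESIS side of percolation only: no `θ(p_c)` statement, no node touched.  Lane `prim-bschramm`, seat `prim-bschramm-gen-1` gen 8 (GEN pen; offer O-GR file G3,
lead g25 GO 2026-08-28T05:41Z).  Helper file (`--supports stmt-CriticalPhenomena-4575 --as helper`).  Def-free; class rows only — no `@[conjecture]` declared,
edited or claimed; nothing about `BenjaminiSchramm1996_conj4_endState`, nothing about the print nodes Question 3 / Conj. 7.27 / Conj. 6.
WORD DISCIPLINE: what is typed is the UPPER bound (growth slower than every exponential).  'INTERMEDIATE growth' would also need the superpolynomial LOWER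
bound, which is NOT typed here — MUST-NOT.

CONTENT (`γ_w` = «GrigorchukGrowthRecursion» `gammaW`, `η = 13/16`):
* §1 THE ε-DESCENT: if `γ_w(n) ≤ K e^{t n}` for all `n` then, for every `ε > 0`, `γ_w(n) ≤ K' e^{(ηt + ε) n}` for all `n` (`gammaW_descent`, from the recursion
  `γ_w(n) ≤ 2(m+1) γ_w(i) γ_w(j)`, `i + j ≤ m ≤ η n + 4875`, and `x + 1 ≤ eˣ`); iterating from the crude `γ_w(n) ≤ 24·3ⁿ`:
  **`gammaW_le_exp (τ > 0) : ∃ K, ∀ n, γ_w(n) ≤ K e^{τ n}`** — the weighted growth is slower than every exponential.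
* §2 TRANSFER to the Cayley graph `Cay(𝔊; a, b, c, d)` (`SimpleGraph.mulCayley`, vertex type `↥grigorchukGroup`, generators F-MP1's `aG bG cG dG`): a vertex at graph
  distance `≤ n` from `1` is a word of `≤ n` letters (the generators are involutions), of weighted length `≤ 3400 n`, so `|B(1, n)| ≤ γ_w(3400 n)`;
  **`not_hasExponentialGrowth_cayley : ¬ HasExponentialGrowth (Cay(𝔊; a,b,c,d))`** (the tree's eventual form «SubexponentialGrowthZd» :150, refuted at the
  vertex `1`).
* §3 CUSTOMERS: **`isGraphAmenable_cayley`** (contrapositive of Literature `hasExponentialGrowth_of_not_isGraphAmenable`, «BLPSCriticalReduction» :135),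
  **`uniquenessProb_eq_criticalProb_cayley : p_u(Cay(𝔊; a,b,c,d)) = p_c`** (Literature «UniquenessAmenable» p596858) and, with O-MP's
  `grigorchukGroup_standardGens_criticalProb_lt_one` (p607347), **`uniquenessProb_cayley_lt_one : p_u(Cay(𝔊; a,b,c,d)) < 1`** — a non-trivial uniqueness phase on
  a Cayley graph of an infinite TORSION group, kernel.  In print: Grigorchuk 1984 (growth), hence amenability (folklore: subexponential ⇒ amenable), p_c = p_u on
  amenable quasi-transitive graphs (Lyons–Peres Thm 7.6 / Burton–Keane); nothing here is claimed new in print.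
[cite: Grigorchuk1984, Thm. (the growth of 𝔊 is subexponential) and the length-reduction lemma] [cite: Bartholdi1998, Prop. (η-contraction at level one)]
[cite: LyonsPeres2016, §6.1 p. 279 (nonamenable ⇒ exponential growth); Thm. 7.6 (p_c = p_u under amenability)] [cite: BenjaminiSchramm1996, §2 Conj. 1; Question 3]
-/

noncomputable section

namespace Summit.CriticalPhenomena.PercolationContinuityZ3.Theorems.Transplant

namespace Grigorchuk

open SimpleGraph Filter Literature.Barriers.CriticalPhenomena Literature.Probability.Percolation Literature.Probability.LatticeModels
open scoped Classical Topology

/-! ## §1 The ε-descent on the exponential rate -/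

/-- A linear function is below every exponential: `n + 6001 ≤ (1/ε + 6001)·e^{ε n}`. [folklore] -/
theorem linear_le_exp {ε : ℝ} (hε : 0 < ε) (n : ℕ) : ((n : ℝ) + 6001) ≤ (1 / ε + 6001) * Real.exp (ε * n) := by
  have h1 : ε * n + 1 ≤ Real.exp (ε * n) := Real.add_one_le_exp _
  have h2 : (1 : ℝ) ≤ Real.exp (ε * n) := Real.one_le_exp (by positivity)
  have h3 : (n : ℝ) ≤ (1 / ε) * Real.exp (ε * n) := by
    rw [div_mul_eq_mul_div, one_mul, le_div_iff₀ hε]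
    nlinarith
  nlinarith

/-- **THE DESCENT STEP**: an exponential bound of rate `t ≥ 0` improves to rate `(13/16)·t + ε`, for every `ε > 0` (through «GrigorchukGrowthRecursion»
`gammaW_recursion`). [cite: Grigorchuk1984, proof of the upper bound] [cite: Bartholdi1998, Prop. (η-contraction at level one)] -/
theorem gammaW_descent {t K : ℝ} (ht : 0 ≤ t) (hK : ∀ n : ℕ, (gammaW n : ℝ) ≤ K * Real.exp (t * n)) {ε : ℝ} (hε : 0 < ε) :
    ∃ K' : ℝ, ∀ n : ℕ, (gammaW n : ℝ) ≤ K' * Real.exp ((13 / 16 * t + ε) * n) := by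
  have hK0 : 0 ≤ K := by
    have h := hK 0
    have h1 : (1 : ℝ) ≤ gammaW 0 := by exact_mod_cast gammaW_pos 0
    simp only [Nat.cast_zero, mul_zero, Real.exp_zero, mul_one] at h
    linarith
  refine ⟨2 * (1 / ε + 6001) * K ^ 2 * Real.exp (4875 * t), fun n => ?_⟩
  obtain ⟨i, j, hij, hle⟩ := gammaW_recursion n
  set m : ℕ := 13 * (n + 6000) / 16 with hm
  -- real-number bookkeeping of `m`
  have hm1 : (m : ℝ) ≤ 13 / 16 * n + 4875 := by
    have h16 : 16 * m ≤ 13 * (n + 6000) := by rw [hm]; exact Nat.mul_div_le _ _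
    have : (16 : ℝ) * m ≤ 13 * (n + 6000) := by exact_mod_cast h16
    linarith
  have hm2 : (m : ℝ) + 1 ≤ (n : ℝ) + 6001 := by
    have : m ≤ n + 6000 := by rw [hm]; omega
    have : (m : ℝ) ≤ n + 6000 := by exact_mod_cast this
    linarith
  have hij' : (i : ℝ) + j ≤ m := by exact_mod_cast hij
  -- `γ(i) γ(j) ≤ K² e^{t m}`
  have hprod : (gammaW i : ℝ) * gammaW j ≤ K ^ 2 * Real.exp (t * m) := by
    have hi := hK i
    have hj := hK j
    have hgi : (0 : ℝ) ≤ gammaW i := Nat.cast_nonneg _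
    have hgj : (0 : ℝ) ≤ gammaW j := Nat.cast_nonneg _
    calc (gammaW i : ℝ) * gammaW j ≤ (K * Real.exp (t * i)) * (K * Real.exp (t * j)) :=
          mul_le_mul hi hj hgj (hgi.trans hi)
      _ = K ^ 2 * Real.exp (t * (i + j)) := by rw [mul_add, Real.exp_add]; ring
      _ ≤ K ^ 2 * Real.exp (t * m) := by
          refine mul_le_mul_of_nonneg_left (Real.exp_le_exp.2 (mul_le_mul_of_nonneg_left hij' ht)) (sq_nonneg K)
  -- assemble
  have hle' : (gammaW n : ℝ) ≤ 2 * ((m : ℝ) + 1) * ((gammaW i : ℝ) * gammaW j) := by exact_mod_cast hle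
  have hlin := linear_le_exp hε n
  have hexp : Real.exp (t * m) ≤ Real.exp (4875 * t) * Real.exp (13 / 16 * t * n) := by
    rw [← Real.exp_add]
    refine Real.exp_le_exp.2 ?_
    have := mul_le_mul_of_nonneg_left hm1 ht
    linarith
  have hKe : 0 ≤ K ^ 2 * Real.exp (t * m) := by positivity
  have hmlin : (m : ℝ) + 1 ≤ (1 / ε + 6001) * Real.exp (ε * n) := hm2.trans hlin
  calc (gammaW n : ℝ) ≤ 2 * ((m : ℝ) + 1) * (K ^ 2 * Real.exp (t * m)) := hle'.trans (by gcongr)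
    _ ≤ 2 * ((1 / ε + 6001) * Real.exp (ε * n)) * (K ^ 2 * (Real.exp (4875 * t) * Real.exp (13 / 16 * t * n))) := by
        gcongr
    _ = 2 * (1 / ε + 6001) * K ^ 2 * Real.exp (4875 * t) * Real.exp ((13 / 16 * t + ε) * n) := by
        rw [show (13 / 16 * t + ε) * (n : ℝ) = 13 / 16 * t * n + ε * n by ring, Real.exp_add]; ring

/-- Weakening the rate. [folklore] -/
theorem gammaW_bound_mono {t t' K : ℝ} (h : t ≤ t') (hK : ∀ n : ℕ, (gammaW n : ℝ) ≤ K * Real.exp (t * n)) :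
    ∀ n : ℕ, (gammaW n : ℝ) ≤ K * Real.exp (t' * n) := by
  have hK0 : 0 ≤ K := by
    have h0 := hK 0
    have h1 : (1 : ℝ) ≤ gammaW 0 := by exact_mod_cast gammaW_pos 0
    simp only [Nat.cast_zero, mul_zero, Real.exp_zero, mul_one] at h0
    linarith
  intro n
  exact (hK n).trans (mul_le_mul_of_nonneg_left (Real.exp_le_exp.2 (mul_le_mul_of_nonneg_right h (Nat.cast_nonneg n))) hK0)

/-- The crude start: `γ_w(n) ≤ 24·3ⁿ = 24·e^{(log 3) n}`. [folklore] -/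
theorem gammaW_le_exp_log_three : ∀ n : ℕ, (gammaW n : ℝ) ≤ 24 * Real.exp (Real.log 3 * n) := by
  intro n
  have h' : (gammaW n : ℝ) ≤ 8 * 3 ^ (n + 1) := by exact_mod_cast gammaW_le_pow n
  have e : Real.exp (Real.log 3 * n) = (3 : ℝ) ^ n := by
    rw [mul_comm, Real.exp_nat_mul, Real.exp_log (by norm_num : (0 : ℝ) < 3)]
  rw [e]
  calc (gammaW n : ℝ) ≤ 8 * 3 ^ (n + 1) := h'
    _ = 24 * (3 : ℝ) ^ n := by rw [pow_succ]; ring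

/-- The iterated descent: for every `k` and `ε > 0`, rate `η^k·log 3 + 6ε`. [cite: Grigorchuk1984, proof of the upper bound] -/
theorem gammaW_le_exp_iter (ε : ℝ) (hε : 0 < ε) :
    ∀ k : ℕ, ∃ K : ℝ, ∀ n : ℕ, (gammaW n : ℝ) ≤ K * Real.exp (((13 / 16 : ℝ) ^ k * Real.log 3 + 6 * ε) * n) := by
  have hl3 : 0 ≤ Real.log 3 := Real.log_nonneg (by norm_num)
  intro k
  induction k with
  | zero =>
    refine ⟨24, gammaW_bound_mono ?_ gammaW_le_exp_log_three⟩
    rw [pow_zero, one_mul]; linarith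
  | succ k ih =>
    obtain ⟨K, hK⟩ := ih
    have ht : 0 ≤ (13 / 16 : ℝ) ^ k * Real.log 3 + 6 * ε :=
      add_nonneg (mul_nonneg (pow_nonneg (by norm_num) k) hl3) (by linarith)
    obtain ⟨K', hK'⟩ := gammaW_descent ht hK hε
    refine ⟨K', gammaW_bound_mono ?_ hK'⟩
    rw [pow_succ]; nlinarith [pow_nonneg (show (0 : ℝ) ≤ 13 / 16 by norm_num) k]

/-- **THE FIRST GRIGORCHUK GROUP HAS SUBEXPONENTIAL (WEIGHTED) GROWTH: `γ_w(n) ≤ K_τ e^{τ n}` for every `τ > 0`** — Grigorchuk 1984's upper bound, in Bartholdi's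
level-one weighted form. [cite: Grigorchuk1984, Thm. (subexponential growth)] [cite: Bartholdi1998, Prop. (η-contraction at level one)] -/
theorem gammaW_le_exp {τ : ℝ} (hτ : 0 < τ) : ∃ K : ℝ, ∀ n : ℕ, (gammaW n : ℝ) ≤ K * Real.exp (τ * n) := by
  have hl3 : 0 < Real.log 3 := Real.log_pos (by norm_num)
  obtain ⟨k, hk⟩ := exists_pow_lt_of_lt_one (div_pos hτ (mul_pos two_pos hl3)) (show (13 / 16 : ℝ) < 1 by norm_num)
  obtain ⟨K, hK⟩ := gammaW_le_exp_iter (τ / 12) (by linarith) k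
  refine ⟨K, gammaW_bound_mono ?_ hK⟩
  have h1 : (13 / 16 : ℝ) ^ k * Real.log 3 < τ / (2 * Real.log 3) * Real.log 3 := mul_lt_mul_of_pos_right hk hl3
  have h2 : τ / (2 * Real.log 3) * Real.log 3 = τ / 2 := by
    rw [div_mul_eq_mul_div, mul_comm 2 (Real.log 3), ← div_div, mul_div_assoc, div_self hl3.ne', mul_one]
  rw [h2] at h1
  linarith

/-! ## §2 Transfer to the Cayley graph `Cay(𝔊; a, b, c, d)` -/

/-- The standard generating set of `𝔊` as a finite subset of the subtype (F-MP1's `aG bG cG dG`). [cite: Grigorchuk1980, definition of the group] -/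
theorem coe_gen_eq_letter {s : ↥grigorchukGroup} (hs : s ∈ ({aG, bG, cG, dG} : Finset ↥grigorchukGroup)) :
    ∃ ℓ : Letter, ℓ.toPerm = (s : Equiv.Perm Ray) ∧ s * s = 1 := by
  obtain ⟨ha, hd, -⟩ := gens_relations
  simp only [Finset.mem_insert, Finset.mem_singleton] at hs
  rcases hs with rfl | rfl | rfl | rfl
  · exact ⟨.a, rfl, ha⟩
  · exact ⟨.x .b, rfl, Subtype.ext (V4.toPerm_mul .b .b).symm⟩
  · exact ⟨.x .c, rfl, Subtype.ext (V4.toPerm_mul .c .c).symm⟩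
  · exact ⟨.x .d, rfl, hd⟩

/-- **A walk of length `k` in `Cay(𝔊; a,b,c,d)` is a word of `≤ k` letters** (right multiplication by involutions). [cite: LyonsPeres2016, §7.2 (Cayley graphs: word metric)] -/
theorem exists_word_of_walk {u v : ↥grigorchukGroup} (p : (mulCayley (↑({aG, bG, cG, dG} : Finset ↥grigorchukGroup) : Set ↥grigorchukGroup)).Walk u v) :
    ∃ w : List Letter, w.length ≤ p.length ∧ (u : Equiv.Perm Ray) * (w.map Letter.toPerm).prod = (v : Equiv.Perm Ray) := by
  induction p with
  | nil => exact ⟨[], le_rfl, by simp⟩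
  | @cons x y z hadj p ih =>
    obtain ⟨w, hw, hprod⟩ := ih
    rw [mulCayley_adj'] at hadj
    obtain ⟨-, s, hs, hxy⟩ := hadj
    obtain ⟨ℓ, hℓ, hss⟩ := coe_gen_eq_letter (Finset.mem_coe.1 hs)
    have hy : (y : Equiv.Perm Ray) = (x : Equiv.Perm Ray) * ℓ.toPerm := by
      rcases hxy with h | h
      · rw [← h, Subgroup.coe_mul, hℓ]
      · -- `x = y s` and `s² = 1` give `y = x s`
        have e : y = x * s := by rw [h, mul_assoc, hss, mul_one]
        rw [e, Subgroup.coe_mul, hℓ]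
    refine ⟨ℓ :: w, by rw [List.length_cons, SimpleGraph.Walk.length_cons]; omega, ?_⟩
    rw [List.map_cons, List.prod_cons, ← mul_assoc, ← hy, hprod]

/-- **`|B(1, n)| ≤ γ_w(3400 n)` in `Cay(𝔊; a,b,c,d)`.** [cite: Grigorchuk1984, the growth function] [cite: Bartholdi1998, Prop. (the weighted metric)] -/
theorem ballVolume_le_gammaW (n : ℕ) :
    ballVolume (mulCayley (↑({aG, bG, cG, dG} : Finset ↥grigorchukGroup) : Set ↥grigorchukGroup)) 1 n ≤ gammaW (3400 * n) := by
  unfold ballVolume gammaW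
  rw [← Set.ncard_coe_finset]
  refine Set.ncard_le_ncard_of_injOn (fun g : ↥grigorchukGroup => (g : Equiv.Perm Ray)) (fun g hg => ?_) (fun _ _ _ _ h => Subtype.ext h)
    (Finset.finite_toSet _)
  obtain ⟨p, hp⟩ := hg
  obtain ⟨w, hw, hprod⟩ := exists_word_of_walk p
  rw [Subgroup.coe_one, one_mul] at hprod
  show (g : Equiv.Perm Ray) ∈ (↑(wball (3400 * n)) : Set (Equiv.Perm Ray))
  rw [Finset.mem_coe, ← hprod]
  exact wball_mono (by have := wordLW_le w; omega) (prod_mem_wball w)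

/-- **`Cay(𝔊; a, b, c, d)` DOES NOT HAVE EXPONENTIAL GROWTH** (the tree's eventual form `∀ x ∃ c > 1, c^n ≤ |B(x,n)|` eventually — refuted at `x = 1`): for any `c > 1`,
`|B(1,n)| ≤ γ_w(3400 n) ≤ K e^{(log c / 2) n} = K (√c)^n` contradicts `c^n ≤ |B(1,n)|`. [cite: Grigorchuk1984, Thm. (subexponential growth)] -/
theorem not_hasExponentialGrowth_cayley :
    ¬ HasExponentialGrowth (mulCayley (↑({aG, bG, cG, dG} : Finset ↥grigorchukGroup) : Set ↥grigorchukGroup)) := by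
  intro h
  obtain ⟨c, hc, hev⟩ := h 1
  have hc0 : 0 < c := by linarith
  -- rate `τ = log c / 6800`, so that `τ · 3400 n = (log c / 2) n`; `r = e^{log c / 2} = √c > 1`, `r² = c`
  set r : ℝ := Real.exp (Real.log c / 2) with hr
  have hr1 : 1 < r := by rw [hr]; exact Real.one_lt_exp_iff.2 (by have := Real.log_pos hc; linarith)
  have hr0 : 0 < r := by linarith
  have hrr : r * r = c := by rw [hr, ← Real.exp_add, add_halves, Real.exp_log hc0]
  obtain ⟨K, hK⟩ := gammaW_le_exp (show 0 < Real.log c / 6800 by have := Real.log_pos hc; positivity)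
  -- eventually `r^n ≤ K`, absurd since `r^n → ∞`
  have hbound : ∀ᶠ n : ℕ in atTop, r ^ n ≤ K := by
    filter_upwards [hev] with n hn
    have h1 : (ballVolume (mulCayley (↑({aG, bG, cG, dG} : Finset ↥grigorchukGroup) : Set ↥grigorchukGroup)) 1 n : ℝ) ≤ gammaW (3400 * n) := by
      exact_mod_cast ballVolume_le_gammaW n
    have h2 := hK (3400 * n)
    have h3 : Real.exp (Real.log c / 6800 * ((3400 * n : ℕ) : ℝ)) = r ^ n := by
      rw [hr, ← Real.exp_nat_mul]; congr 1; push_cast; ring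
    rw [h3] at h2
    have h4 : c ^ n = r ^ n * r ^ n := by rw [← mul_pow, hrr]
    have h5 : r ^ n * r ^ n ≤ K * r ^ n := by rw [← h4]; exact hn.trans (h1.trans h2)
    exact le_of_mul_le_mul_right h5 (pow_pos hr0 n)
  have hgrow := (tendsto_pow_atTop_atTop_of_one_lt hr1).eventually_gt_atTop K
  obtain ⟨n, hn1, hn2⟩ := (hbound.and hgrow).exists
  exact absurd hn1 (not_le.2 hn2)

/-! ## §3 Customers: amenability, `p_u = p_c < 1` -/

/-- **`Cay(𝔊; a, b, c, d)` IS AMENABLE** (a quasi-transitive graph of subexponential growth; contrapositive of Literature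
`hasExponentialGrowth_of_not_isGraphAmenable`). [cite: LyonsPeres2016, §6.1 p. 279 (nonamenable ⇒ exponential growth)] [cite: Grigorchuk1984, Thm. (subexponential growth)] -/
theorem isGraphAmenable_cayley : IsGraphAmenable (mulCayley (↑({aG, bG, cG, dG} : Finset ↥grigorchukGroup) : Set ↥grigorchukGroup)) := by
  by_contra hna
  exact not_hasExponentialGrowth_cayley
    (hasExponentialGrowth_of_not_isGraphAmenable _ (CayleyScaled.isQuasiTransitive_mulCayley _) hna)

/-- **`p_u = p_c` on `Cay(𝔊; a, b, c, d)`** (amenable quasi-transitive: Literature «UniquenessAmenable» p596858). [cite: LyonsPeres2016, Thm. 7.6]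
[cite: BenjaminiSchramm1996, Conj. 6 (amenability side)] -/
theorem uniquenessProb_eq_criticalProb_cayley (g : ↥grigorchukGroup) :
    uniquenessProb (mulCayley (↑({aG, bG, cG, dG} : Finset ↥grigorchukGroup) : Set ↥grigorchukGroup)) =
      criticalProb (mulCayley (↑({aG, bG, cG, dG} : Finset ↥grigorchukGroup) : Set ↥grigorchukGroup)) g :=
  uniquenessProb_eq_criticalProb_of_amenable _ (CayleyScaled.connected_mulCayley_of_closure _ closure_gens_finset)
    (CayleyScaled.isQuasiTransitive_mulCayley _) isGraphAmenable_cayley g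

/-- **`p_u(Cay(𝔊; a, b, c, d)) < 1`**: a non-trivial UNIQUENESS phase on the standard Cayley graph of the first Grigorchuk group (amenability above + O-MP's
`p_c < 1`, p607347) — kernel.  Nothing about the print nodes Question 3 / Conj. 7.27 (no 'one end' is typed) and nothing about `θ(p_c)`.
[cite: LyonsPeres2016, Thm. 7.6] [cite: BenjaminiSchramm1996, Question 3 (p. 79)] [cite: MuchnikPak2001, Thm. 1] -/
theorem uniquenessProb_cayley_lt_one :
    uniquenessProb (mulCayley (↑({aG, bG, cG, dG} : Finset ↥grigorchukGroup) : Set ↥grigorchukGroup)) < 1 := by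
  rw [uniquenessProb_eq_criticalProb_cayley 1]
  exact grigorchukGroup_standardGens_criticalProb_lt_one 1

end Grigorchuk

end Summit.CriticalPhenomena.PercolationContinuityZ3.Theorems.Transplant

end
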